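import Mathlib
import Summits.NavierStokesRegularity.NavierStokesRegularity.Theorems.LevelSetModerationHighSpeedPressureWorkTransfer
import Summits.NavierStokesRegularity.NavierStokesRegularity.Theorems.LevelSetModerationHighSpeedPressureWorkPairingOfPressureBound
import Summits.NavierStokesRegularity.NavierStokesRegularity.Theorems.LevelSetModerationLevelSetClosure
import Literature.Analysis.FluidPDE.NormalisedPressureLpClass

/-!
# Route LevelSetModeration — `HighSpeedPressureWork`: the moderated Cauchy–Schwarz reduction on a time window, and the slice `L²` bound for the pressure on a set

Support file for item stmt-NavierStokesRegularity-18149 (`HighSpeedPressureWork`). Two tools for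
Hölder-type bounds of the pressure work `PW_c(t) = -∫₀ᵗ∫ (1 - c/|u|)₊ D(p̃[u τ])(u)` on the
super-level sets `{c < |u|}` of a classical Leray–Hopf solution:

* `levelSetModeration_pairing_le_sqrt_moderated` — the **window form of the birth-line transfer**
  (`levelSetModeration_highSpeedPressureWork_of_headDecorrelation`): for every jointly continuous
  moderator `Φ`, `PW_c(t) ≤ ‖(p̃ - Φ(τ,|u|)) 1_{c<|u|}‖_{L²((0,t)×ℝ³)} · √(D_c(T))` as soon as the
  first factor is finite (Tao's normalisation, slice integration by parts `stub_levelSetIBP`,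
  `ModerationIdentity`, Hölder on the slice, Cauchy–Schwarz in time);
* `levelSetModeration_fastSetPressureSq_le` — **the pressure on a set of finite measure**: for
  `q > 2`, `∫ 1_A p̃[w]² ≤ C_q² G^{4-4/q} (∫|w|²)^{2/q} |A|^{1-2/q}` whenever `|w| ≤ G` (Hölder on
  `A`, Stein's `L^q` bound for `w ↦ p̃[w] = ℛᵢℛⱼ(wᵢwⱼ)`, interpolation `L² ∩ L^∞ ⊂ L^{2q}`),

with the generic lower-Lebesgue-integral inequalities they rest on (two-weight Hölder
`∫⁻ f^θ g^{1-θ} ≤ (∫⁻ f)^θ (∫⁻ g)^{1-θ}`, Hölder against an indicator, `L²`-on-a-set from `L^q`,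
interpolation). Consumed by `…PairingHolder` (the Hölder pairing bound
`PW_c(t) ≤ √(C G^{4-4/q} E^{2/q} t^{2/q} V_c(t)^{1-2/q}) √(D_c(T))`).
-/

noncomputable section

-- single-conjunct summit: `Summit.<Summit>.<Problem>` repeats the name by the D-0017 layout
set_option linter.dupNamespace false

namespace Summit.NavierStokesRegularity.NavierStokesRegularity.Theorems

open MeasureTheory Set Filter Topology Function
open scoped ENNReal NNReal RealInnerProductSpace
open Literature.Analysis.FluidPDE

/-! ### Generic tools: a two-weight Hölder inequality, Hölder against an indicator, interpolation -/

/-- **Hölder with weights `θ, 1-θ`** for lower Lebesgue integrals: for a.e.-measurable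
`f, g : α → [0,∞]` and `0 < θ < 1`, `∫⁻ f^θ g^{1-θ} ≤ (∫⁻ f)^θ (∫⁻ g)^{1-θ}` (Hölder with the
conjugate exponents `1/θ, 1/(1-θ)`). [folklore] -/
theorem levelSetModeration_lintegral_rpow_mul_rpow_le {α : Type*} [MeasurableSpace α]
    (μ : Measure α) {f g : α → ℝ≥0∞} (hf : AEMeasurable f μ) (hg : AEMeasurable g μ) {θ : ℝ}
    (h0 : 0 < θ) (h1 : θ < 1) :
    ∫⁻ a, f a ^ θ * g a ^ (1 - θ) ∂μ ≤ (∫⁻ a, f a ∂μ) ^ θ * (∫⁻ a, g a ∂μ) ^ (1 - θ) := by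
  have h1' : 0 < 1 - θ := by linarith
  have hpq : (θ⁻¹).HolderConjugate ((1 - θ)⁻¹) := Real.HolderConjugate.inv_inv h0 h1' (by ring)
  have h := ENNReal.lintegral_mul_le_Lp_mul_Lq μ hpq (hf.pow_const θ) (hg.pow_const (1 - θ))
  have hf' : ∀ a, (f a ^ θ) ^ θ⁻¹ = f a := fun a => by
    rw [← ENNReal.rpow_mul, mul_inv_cancel₀ h0.ne', ENNReal.rpow_one]
  have hg' : ∀ a, (g a ^ (1 - θ)) ^ (1 - θ)⁻¹ = g a := fun a => by
    rw [← ENNReal.rpow_mul, mul_inv_cancel₀ h1'.ne', ENNReal.rpow_one]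
  simp only [Pi.mul_apply, hf', hg', one_div, inv_inv] at h
  exact h

/-- **Hölder against an indicator**: for `f : α → [0,∞]` a.e.-measurable, `A` measurable and
`0 < θ < 1`, `∫⁻ 1_A f ≤ (∫⁻ f^{1/θ})^θ |A|^{1-θ}`. [folklore] -/
theorem levelSetModeration_lintegral_indicator_le_rpow_mul_measure {α : Type*} [MeasurableSpace α]
    (μ : Measure α) {f : α → ℝ≥0∞} (hf : AEMeasurable f μ) {A : Set α} (hA : MeasurableSet A)
    {θ : ℝ} (h0 : 0 < θ) (h1 : θ < 1) :
    ∫⁻ a, A.indicator f a ∂μ ≤ (∫⁻ a, f a ^ θ⁻¹ ∂μ) ^ θ * μ A ^ (1 - θ) := by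
  have h1' : 0 < 1 - θ := by linarith
  have key := levelSetModeration_lintegral_rpow_mul_rpow_le μ (hf.pow_const θ⁻¹)
    ((aemeasurable_indicator_iff hA).2 aemeasurable_const : AEMeasurable (A.indicator fun _ => (1 : ℝ≥0∞)) μ)
    h0 h1
  have hlhs : ∀ a, (f a ^ θ⁻¹) ^ θ * (A.indicator (fun _ => (1 : ℝ≥0∞)) a) ^ (1 - θ) =
      A.indicator f a := by
    intro a
    rw [← ENNReal.rpow_mul, inv_mul_cancel₀ h0.ne', ENNReal.rpow_one]
    by_cases ha : a ∈ A
    · rw [indicator_of_mem ha, indicator_of_mem ha, ENNReal.one_rpow, mul_one]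
    · rw [indicator_of_notMem ha, indicator_of_notMem ha, ENNReal.zero_rpow_of_pos h1', mul_zero]
  simp only [hlhs] at key
  rw [lintegral_indicator_const hA, one_mul] at key
  exact key

/-- **`L²` on a set from `Lq`, `q > 2`**: for `f : ℝ³ → ℝ` a.e.-strongly measurable, `A` measurable
and `2 < q < ∞`, `∫⁻ 1_A ofReal(f²) ≤ ‖f‖_q² |A|^{1-2/q}` (Hölder with exponents `q/2` and
`q/(q-2)`). [folklore] -/
theorem levelSetModeration_lintegral_indicator_sq_le_eLpNorm_sq
    {f : EuclideanSpace ℝ (Fin 3) → ℝ} (hf : AEStronglyMeasurable f volume)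
    {A : Set (EuclideanSpace ℝ (Fin 3))} (hA : MeasurableSet A) {q : ℝ} (hq : 2 < q) :
    ∫⁻ x, A.indicator (fun x => ENNReal.ofReal (f x ^ 2)) x ≤
      eLpNorm f (ENNReal.ofReal q) volume ^ (2 : ℝ) * volume A ^ (1 - 2 / q) := by
  have hq0 : 0 < q := by linarith
  have hθ0 : 0 < 2 / q := by positivity
  have hθ1 : 2 / q < 1 := by rw [div_lt_one hq0]; exact hq
  -- the density as a power of the extended norm
  have hdens : (fun x => ENNReal.ofReal (f x ^ 2)) = fun x => ‖f x‖ₑ ^ (2 : ℝ) := by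
    funext x
    rw [Real.enorm_eq_ofReal_abs, ENNReal.ofReal_rpow_of_nonneg (abs_nonneg _) (by norm_num),
      Real.rpow_two, sq_abs]
  have hfm : AEMeasurable (fun x => ‖f x‖ₑ ^ (2 : ℝ)) volume := hf.enorm.pow_const _
  have key := levelSetModeration_lintegral_indicator_le_rpow_mul_measure volume hfm hA hθ0 hθ1
  rw [hdens]
  refine key.trans (le_of_eq ?_)
  congr 1
  -- `(∫⁻ (‖f‖ₑ²)^{q/2})^{2/q} = ‖f‖_q²`
  have hpow : ∀ x, (‖f x‖ₑ ^ (2 : ℝ)) ^ (2 / q)⁻¹ = ‖f x‖ₑ ^ q := fun x => by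
    rw [← ENNReal.rpow_mul]; congr 1; field_simp
  simp only [hpow]
  have hq' : (ENNReal.ofReal q) ≠ 0 := (ENNReal.ofReal_pos.2 hq0).ne'
  rw [eLpNorm_eq_lintegral_rpow_enorm_toReal hq' ENNReal.ofReal_ne_top, ENNReal.toReal_ofReal hq0.le,
    ← ENNReal.rpow_mul]
  congr 1
  field_simp

/-- **Interpolation `L² ∩ L^∞ ⊂ Lʳ`**: if `‖w x‖ ≤ G` everywhere and `2 < r`, then
`‖w‖_r ≤ G^{1-2/r} (∫⁻ ‖w‖ₑ²)^{1/r}`. [folklore] -/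
theorem levelSetModeration_eLpNorm_le_of_norm_le
    {w : EuclideanSpace ℝ (Fin 3) → EuclideanSpace ℝ (Fin 3)} {G : ℝ}
    (hwG : ∀ x, ‖w x‖ ≤ G) {r : ℝ} (hr : 2 < r) :
    eLpNorm w (ENNReal.ofReal r) volume ≤
      ENNReal.ofReal G ^ (1 - 2 / r) * (∫⁻ x, ‖w x‖ₑ ^ 2) ^ (1 / r) := by
  have h2 : (fun x => ‖w x‖ₑ ^ 2) = fun x => ‖w x‖ₑ ^ (2 : ℝ) := by
    funext x; rw [← ENNReal.rpow_natCast]; norm_num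
  rw [h2]
  have hr0 : 0 < r := by linarith
  have hr' : (ENNReal.ofReal r) ≠ 0 := (ENNReal.ofReal_pos.2 hr0).ne'
  rw [eLpNorm_eq_lintegral_rpow_enorm_toReal hr' ENNReal.ofReal_ne_top, ENNReal.toReal_ofReal hr0.le]
  -- pointwise: `‖w‖ₑ^r ≤ G^{r-2} ‖w‖ₑ²`
  have hpt : ∀ x, ‖w x‖ₑ ^ r ≤ ENNReal.ofReal G ^ (r - 2) * ‖w x‖ₑ ^ (2 : ℝ) := by
    intro x
    have hsplit : ‖w x‖ₑ ^ r = ‖w x‖ₑ ^ (r - 2) * ‖w x‖ₑ ^ (2 : ℝ) := by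
      rw [← ENNReal.rpow_add_of_nonneg _ _ (by linarith) (by norm_num)]; congr 1; ring
    rw [hsplit]
    gcongr
    rw [← ofReal_norm]; exact ENNReal.ofReal_le_ofReal (hwG x)
  have hint : ∫⁻ x, ‖w x‖ₑ ^ r ≤ ENNReal.ofReal G ^ (r - 2) * ∫⁻ x, ‖w x‖ₑ ^ (2 : ℝ) := by
    calc ∫⁻ x, ‖w x‖ₑ ^ r ≤ ∫⁻ x, ENNReal.ofReal G ^ (r - 2) * ‖w x‖ₑ ^ (2 : ℝ) :=
          lintegral_mono fun x => hpt x
      _ = ENNReal.ofReal G ^ (r - 2) * ∫⁻ x, ‖w x‖ₑ ^ (2 : ℝ) :=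
          lintegral_const_mul' _ _ (ENNReal.rpow_ne_top_of_nonneg (by linarith) ENNReal.ofReal_ne_top)
  calc (∫⁻ x, ‖w x‖ₑ ^ r) ^ (1 / r)
      ≤ (ENNReal.ofReal G ^ (r - 2) * ∫⁻ x, ‖w x‖ₑ ^ (2 : ℝ)) ^ (1 / r) :=
        ENNReal.rpow_le_rpow hint (by positivity)
    _ = ENNReal.ofReal G ^ (1 - 2 / r) * (∫⁻ x, ‖w x‖ₑ ^ (2 : ℝ)) ^ (1 / r) := by
        have hexp : (r - 2) * (1 / r) = 1 - 2 / r := by field_simp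
        rw [ENNReal.mul_rpow_of_nonneg _ _ (by positivity), ← ENNReal.rpow_mul, hexp]


/-! ### One slice: the `L²` norm of the normalised pressure on a set of finite measure -/

/-- **Slice bound for the pressure on a set.** For every `q > 2` there is `C_q` (the
Calderón–Zygmund constant of `w ↦ p̃[w]` on `L^q`) such that for every a.e.-strongly measurable
field `w : ℝ³ → ℝ³` with `∫⁻ ‖w‖ₑ² < ∞` and `‖w‖ ≤ G` pointwise, and every measurable set `A`,
`∫⁻ 1_A ofReal(p̃[w]²) ≤ C_q² G^{4-4/q} (∫⁻ ‖w‖ₑ²)^{2/q} |A|^{1-2/q}`: Hölder on `A`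
(`levelSetModeration_lintegral_indicator_sq_le_eLpNorm_sq`), Stein's bound `‖p̃[w]‖_q ≤ C_q ‖w‖²_{2q}`
(`exists_eLpNorm_normalisedPressure_le_sq`) and the interpolation `‖w‖_{2q} ≤ G^{1-1/q} (∫⁻‖w‖ₑ²)^{1/(2q)}`
(`levelSetModeration_eLpNorm_le_of_norm_le`). [cite: Stein1971, Ch. II §4.2 Thm 3 (b)] -/
theorem levelSetModeration_fastSetPressureSq_le {q : ℝ} (hq : 2 < q) :
    ∃ C : ℝ≥0, ∀ (w : EuclideanSpace ℝ (Fin 3) → EuclideanSpace ℝ (Fin 3)),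
      AEStronglyMeasurable w volume → (∫⁻ x, ‖w x‖ₑ ^ 2) ≠ ⊤ →
      ∀ (G : ℝ), (∀ x, ‖w x‖ ≤ G) → ∀ (A : Set (EuclideanSpace ℝ (Fin 3))), MeasurableSet A →
      ∫⁻ x, A.indicator (fun x => ENNReal.ofReal (normalisedPressure w x ^ 2)) x ≤
        (C : ℝ≥0∞) ^ (2 : ℝ) * ENNReal.ofReal G ^ (4 - 4 / q) * (∫⁻ x, ‖w x‖ₑ ^ 2) ^ (2 / q) *
          volume A ^ (1 - 2 / q) := by
  have hq0 : 0 < q := by linarith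
  have hq1 : 1 < q := by linarith
  set pq : ℝ≥0∞ := ENNReal.ofReal q with hpq
  have hp1 : 1 < pq := ENNReal.one_lt_ofReal.2 hq1
  have hp2 : pq < ⊤ := ENNReal.ofReal_lt_top
  obtain ⟨C, hC⟩ := exists_eLpNorm_normalisedPressure_le_sq hp1 hp2
  refine ⟨C, fun w hw hE G hG A hA => ?_⟩
  have h2q : 2 * pq = ENNReal.ofReal (2 * q) := by
    rw [hpq, ENNReal.ofReal_mul (by norm_num : (0:ℝ) ≤ 2), ENNReal.ofReal_ofNat]
  have h2q' : (2 : ℝ) < 2 * q := by linarith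
  -- interpolation `‖w‖_{2q} ≤ G^{1-1/q} (∫⁻‖w‖ₑ²)^{1/(2q)}`, in particular `w ∈ L^{2q}`
  set E₂ : ℝ≥0∞ := ∫⁻ x, ‖w x‖ₑ ^ 2 with hE₂
  have hS : eLpNorm w (2 * pq) volume ≤
      ENNReal.ofReal G ^ (1 - 2 / (2 * q)) * E₂ ^ (1 / (2 * q)) := by
    rw [h2q]; exact levelSetModeration_eLpNorm_le_of_norm_le hG h2q'
  have hSfin : eLpNorm w (2 * pq) volume < ⊤ := by
    refine lt_of_le_of_lt hS (ENNReal.mul_lt_top ?_ ?_)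
    · exact ENNReal.rpow_lt_top_of_nonneg (by rw [sub_nonneg, div_le_one (by linarith)]; linarith)
        ENNReal.ofReal_ne_top
    · exact ENNReal.rpow_lt_top_of_nonneg (by positivity) hE
  have hwLp : MemLp w (2 * pq) volume := ⟨hw, hSfin⟩
  -- Stein's bound and measurability of `p̃[w]`
  have hCZ := hC w hwLp
  have hpm : AEStronglyMeasurable (normalisedPressure w) volume :=
    (memLp_normalisedPressure_of_memLp_two_mul hp1 hp2 hwLp).1
  -- Hölder on `A`
  have hH := levelSetModeration_lintegral_indicator_sq_le_eLpNorm_sq hpm hA hq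
  -- assemble
  have hmono : eLpNorm (normalisedPressure w) pq volume ^ (2 : ℝ) ≤
      ((C : ℝ≥0∞) * (ENNReal.ofReal G ^ (1 - 2 / (2 * q)) * E₂ ^ (1 / (2 * q))) ^ 2) ^ (2 : ℝ) := by
    refine ENNReal.rpow_le_rpow (hCZ.trans ?_) (by norm_num)
    gcongr
  have hpow4 : ∀ (x : ℝ≥0∞) (e : ℝ), ((x ^ e) ^ 2) ^ (2 : ℝ) = x ^ (4 * e) := by
    intro x e
    rw [← ENNReal.rpow_natCast, ← ENNReal.rpow_mul, ← ENNReal.rpow_mul]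
    congr 1; push_cast; ring
  have hα : 4 * (1 - 2 / (2 * q)) = 4 - 4 / q := by field_simp
  have hβ : 4 * (1 / (2 * q)) = 2 / q := by field_simp; ring
  have halg : ((C : ℝ≥0∞) * (ENNReal.ofReal G ^ (1 - 2 / (2 * q)) * E₂ ^ (1 / (2 * q))) ^ 2) ^ (2 : ℝ)
      = (C : ℝ≥0∞) ^ (2 : ℝ) * ENNReal.ofReal G ^ (4 - 4 / q) * E₂ ^ (2 / q) := by
    rw [ENNReal.mul_rpow_of_nonneg _ _ (by norm_num : (0:ℝ) ≤ 2), mul_pow,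
      ENNReal.mul_rpow_of_nonneg _ _ (by norm_num : (0:ℝ) ≤ 2), hpow4, hpow4, hα, hβ, mul_assoc]
  calc ∫⁻ x, A.indicator (fun x => ENNReal.ofReal (normalisedPressure w x ^ 2)) x
      ≤ eLpNorm (normalisedPressure w) pq volume ^ (2 : ℝ) * volume A ^ (1 - 2 / q) := hH
    _ ≤ ((C : ℝ≥0∞) * (ENNReal.ofReal G ^ (1 - 2 / (2 * q)) * E₂ ^ (1 / (2 * q))) ^ 2) ^ (2 : ℝ) *
          volume A ^ (1 - 2 / q) := by gcongr
    _ = (C : ℝ≥0∞) ^ (2 : ℝ) * ENNReal.ofReal G ^ (4 - 4 / q) * E₂ ^ (2 / q) *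
          volume A ^ (1 - 2 / q) := by rw [halg]

/-! ### Cauchy–Schwarz in time with a moderator, on the window `(0, t)` -/

/-- **The moderated Cauchy–Schwarz reduction on a time window.** Let `u` be a classical solution of
unforced Navier–Stokes on `ℝ³ × [0,T)` (`ν, T > 0`), Leray–Hopf from a rapidly decaying datum,
`c > 0`, `t ∈ [0,T)`, and `Φ : ℝ → ℝ → ℝ` a jointly continuous moderator. If the moderated pressure
fluctuation on the fast set has finite space–time `L²` norm over `(0,t)`, then
`-∫₀ᵗ∫ (1 - c/|u|)₊ D(p̃[u τ])(u) ≤ √(∫₀ᵗ∫ 1_{c<|u|} (p̃ - Φ(τ,|u|))²) · √(D_c(T))`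
(Tao's normalisation makes the slices `C¹`; slice integration by parts `stub_levelSetIBP`,
`ModerationIdentity` and Hölder, `levelSetModeration_moderatedCauchySchwarz_slice_lintegral`; then
Cauchy–Schwarz in time, `levelSetModeration_setIntegral_le_sqrt_mul_sqrt`). The window form of the
birth-line transfer `levelSetModeration_highSpeedPressureWork_of_headDecorrelation`. [folklore] -/
theorem levelSetModeration_pairing_le_sqrt_moderated {ν T : ℝ}
    {u : ℝ → EuclideanSpace ℝ (Fin 3) → EuclideanSpace ℝ (Fin 3)}
    {p : ℝ → EuclideanSpace ℝ (Fin 3) → ℝ} (hν : 0 < ν) (hT : 0 < T)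
    (hcl : IsClassicalNSSolutionOn (Ico 0 T) ν 0 u p) (hLH : IsLerayHopfOn T ν 0 (u 0) u)
    (hdec : HasRapidSpatialDecay (u 0)) {c t : ℝ} (hc : 0 < c) (ht : t ∈ Ico 0 T)
    {Φ : ℝ → ℝ → ℝ} (hΦ : Continuous (uncurry Φ))
    (hfin : (∫⁻ τ in Ioo 0 t, ∫⁻ x, {x | c < ‖u τ x‖}.indicator
      (fun x => ENNReal.ofReal ((normalisedPressure (u τ) x - Φ τ ‖u τ x‖) ^ 2)) x) ≠ ⊤) :
    -(∫ τ in Ioo 0 t, ∫ x, max (1 - c / ‖u τ x‖) 0 *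
        (fderiv ℝ (normalisedPressure (u τ)) x (u τ x))) ≤
      Real.sqrt (∫⁻ τ in Ioo 0 t, ∫⁻ x, {x | c < ‖u τ x‖}.indicator
          (fun x => ENNReal.ofReal ((normalisedPressure (u τ) x - Φ τ ‖u τ x‖) ^ 2)) x).toReal *
        Real.sqrt ((∫⁻ τ in Ioo 0 T, ∫⁻ x, {x | c < ‖u τ x‖}.indicator
          (fun x => ENNReal.ofReal (‖fderiv ℝ (fun y => ‖u τ y‖) x‖ ^ 2)) x).toReal) := by
  -- the case `t = 0`: nothing to integrate
  rcases eq_or_lt_of_le ht.1 with ht0 | ht0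
  · rw [← ht0, Ioo_self, Measure.restrict_empty, integral_zero_measure, neg_zero]
    exact mul_nonneg (Real.sqrt_nonneg _) (Real.sqrt_nonneg _)
  -- notation
  set Bsl : ℝ → ℝ≥0∞ := fun τ => ∫⁻ x, {x | c < ‖u τ x‖}.indicator
      (fun x => ENNReal.ofReal (‖fderiv ℝ (fun y => ‖u τ y‖) x‖ ^ 2)) x with hBsl
  set A₀ : ℝ → ℝ≥0∞ := fun τ => ∫⁻ x, {x | c < ‖u τ x‖}.indicator
      (fun x => ENNReal.ofReal ((normalisedPressure (u τ) x - Φ τ ‖u τ x‖) ^ 2)) x with hA₀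
  set Asl : ℝ → ℝ≥0∞ := (Ioo 0 t).indicator A₀ with hAsl
  set P : ℝ → ℝ := fun τ => ∫ x, max (1 - c / ‖u τ x‖) 0 *
      (fderiv ℝ (normalisedPressure (u τ)) x (u τ x)) with hP
  -- Tao's pressure normalisation on the closed slab `[0, T']`, `T' = (t+T)/2`
  set T' : ℝ := (t + T) / 2 with hT'
  have hT'pos : 0 < T' := by rw [hT']; linarith [ht.2]
  have htT' : t < T' := by rw [hT']; linarith [ht.2]
  have hT'T : T' < T := by rw [hT']; linarith [ht.2]
  have hcl' : IsClassicalNSSolutionOn (Icc 0 T') ν 0 u p :=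
    hcl.mono (Icc_subset_Ico_right hT'T) (uniqueDiffOn_Icc hT'pos)
  have hEn : ∃ C : ℝ≥0∞, C < ⊤ ∧ ∀ τ ∈ Icc 0 T', ∫⁻ x, ‖u τ x‖ₑ ^ 2 ≤ C :=
    ⟨ENNReal.ofReal (2 * VectorCalculus.kineticEnergy (u 0)), ENNReal.ofReal_lt_top, fun τ hτ =>
      hLH.lintegral_enorm_sq_le hν.le ⟨hτ.1, hτ.2.trans hT'T.le⟩⟩
  obtain ⟨C, hCmeas, -, hnorm⟩ := tao_pressure_normalisation_holds ν T' hν hT'pos u p hcl' hEn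
  have hsubIcc : Ioo 0 t ⊆ Icc 0 T' := fun τ hτ => ⟨hτ.1.le, hτ.2.le.trans htT'.le⟩
  have hnorm' : ∀ᵐ τ ∂(volume.restrict (Ioo 0 t)), ∀ x, p τ x = normalisedPressure (u τ) x + C τ :=
    ae_restrict_of_ae_restrict_of_subset hsubIcc hnorm
  -- (a) a.e.-measurability of the slices
  have hB : AEMeasurable Bsl (volume.restrict (Ioo 0 t)) :=
    levelSetModeration_aemeasurable_dissipationSlice hcl.smooth_velocity hc ht.2.le
  have hq : AEMeasurable (uncurry fun τ x => normalisedPressure (u τ) x)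
      ((volume.restrict (Ioo 0 t)).prod (volume : Measure (EuclideanSpace ℝ (Fin 3)))) := by
    refine (levelSetModeration_aemeasurable_pressure_sub hcl.smooth_pressure hCmeas ht.2.le).congr ?_
    refine levelSetModeration_ae_prod_of_ae_forall ?_
    filter_upwards [hnorm'] with τ hτ x
    simp only [uncurry_apply_pair]
    linarith [hτ x]
  have hA₀m : AEMeasurable A₀ (volume.restrict (Ioo 0 t)) :=
    levelSetModeration_aemeasurable_moderatedSlice hcl.smooth_velocity c ht.2.le hq hΦ
  have hA : AEMeasurable Asl (volume.restrict (Ioo 0 t)) := by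
    refine hA₀m.congr ?_
    filter_upwards [ae_restrict_mem measurableSet_Ioo] with τ hτ
    rw [hAsl, indicator_of_mem hτ]
  -- (b) finiteness of the time integrals over `(0, T)`
  have hAeq : ∫⁻ τ in Ioo 0 T, Asl τ = ∫⁻ τ in Ioo 0 t, A₀ τ := by
    rw [hAsl, lintegral_indicator measurableSet_Ioo, Measure.restrict_restrict measurableSet_Ioo,
      inter_eq_left.2 (Ioo_subset_Ioo le_rfl ht.2.le)]
  have hAfin : ∫⁻ τ in Ioo 0 T, Asl τ ≠ ∞ := by rw [hAeq]; exact hfin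
  have hBfin : ∫⁻ τ in Ioo 0 T, Bsl τ ≠ ∞ := (levelSetDissipation_ne_top hcl hLH hT hν.le hc.le).1
  -- (c) the slice inequality for a.e. `τ ∈ (0, t)`
  have hslice : ∀ᵐ τ ∂(volume.restrict (Ioo 0 t)),
      -P τ ≤ Real.sqrt (Asl τ).toReal * Real.sqrt (Bsl τ).toReal := by
    filter_upwards [hnorm', ae_restrict_mem measurableSet_Ioo] with τ hτn hτ
    have hτ' : τ ∈ Ico 0 T := ⟨hτ.1.le, hτ.2.trans ht.2⟩
    set qτ : EuclideanSpace ℝ (Fin 3) → ℝ := fun x => p τ x - C τ with hqτ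
    have hq_eq : normalisedPressure (u τ) = qτ := by
      funext x
      have := hτn x
      rw [hqτ]
      linarith
    have hv : ContDiff ℝ 1 (u τ) := (hcl.contDiff_velocity hτ').of_le (by norm_cast)
    have hqC1 : ContDiff ℝ 1 qτ :=
      ((hcl.contDiff_pressure hτ').of_le (by norm_cast)).sub contDiff_const
    have hdiv : VectorCalculus.IsDivFree (u τ) := hcl.divFree τ hτ'
    have hbdd : Bornology.IsBounded {x | c < ‖u τ x‖} :=
      levelSetModeration_isBounded_superlevel ν T u p hν hcl hLH hdec τ hτ' c hc
    have hφ : Continuous (Φ τ) := hΦ.comp (Continuous.prodMk_right τ)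
    have key := levelSetModeration_moderatedCauchySchwarz_slice_lintegral hc hv hdiv hbdd
      hqC1.continuous hφ (stub_levelSetIBP (u τ) qτ c hc hv hqC1 hdiv hbdd)
    have hAτ : Asl τ = A₀ τ := by rw [hAsl, indicator_of_mem hτ]
    rw [hAτ, hA₀, hP]
    simp only []
    rw [hq_eq]
    exact key
  -- (d) Cauchy–Schwarz in time
  have hCS := levelSetModeration_setIntegral_le_sqrt_mul_sqrt t T (fun τ => -P τ) Asl Bsl ht.2.le
    hA hB hAfin hBfin hslice
  -- (e) conclusion
  have hneg : -(∫ τ in Ioo 0 t, P τ) = ∫ τ in Ioo 0 t, -P τ := (integral_neg P).symm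
  rw [hneg, ← hAeq]
  exact hCS

/-- **The moderated Cauchy–Schwarz reduction on a time window** (closed form of
`levelSetModeration_pairing_le_sqrt_moderated`, registered sub-goal of the crux item): for a
classical Leray–Hopf solution on `ℝ³ × [0,T)` from a rapidly decaying datum, `c > 0`, `t ∈ [0,T)`
and a jointly continuous moderator `Φ` with `∫₀ᵗ∫ 1_{c<|u|} (p̃ - Φ(τ,|u|))² < ∞`,
`-∫₀ᵗ∫ (1 - c/|u|)₊ D(p̃[u τ])(u) ≤ √(∫₀ᵗ∫ 1_{c<|u|} (p̃ - Φ(τ,|u|))²) · √(D_c(T))`. [folklore] -/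
theorem levelSetModeration_pairingSqrtModerated :
    ∀ (ν T : ℝ) (u : ℝ → EuclideanSpace ℝ (Fin 3) → EuclideanSpace ℝ (Fin 3)) (p : ℝ → EuclideanSpace ℝ (Fin 3) → ℝ), 0 < ν → 0 < T → Literature.Analysis.FluidPDE.IsClassicalNSSolutionOn (Set.Ico 0 T) ν 0 u p → Literature.Analysis.FluidPDE.IsLerayHopfOn T ν 0 (u 0) u → Literature.Analysis.FluidPDE.HasRapidSpatialDecay (u 0) → ∀ (c t : ℝ) (Φ : ℝ → ℝ → ℝ), 0 < c → t ∈ Set.Ico 0 T → Continuous (Function.uncurry Φ) → (∫⁻ τ in Set.Ioo 0 t, ∫⁻ x, Set.indicator {x | c < ‖u τ x‖} (fun x => ENNReal.ofReal ((Literature.Analysis.FluidPDE.normalisedPressure (u τ) x - Φ τ ‖u τ x‖) ^ 2)) x) ≠ ⊤ → -(∫ τ in Set.Ioo 0 t, ∫ x, max (1 - c / ‖u τ x‖) 0 * (fderiv ℝ (Literature.Analysis.FluidPDE.normalisedPressure (u τ)) x (u τ x))) ≤ Real.sqrt (∫⁻ τ in Set.Ioo 0 t, ∫⁻ x, Set.indicator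 {x | c < ‖u τ x‖} (fun x => ENNReal.ofReal ((Literature.Analysis.FluidPDE.normalisedPressure (u τ) x - Φ τ ‖u τ x‖) ^ 2)) x).toReal * Real.sqrt ((∫⁻ τ in Set.Ioo 0 T, ∫⁻ x, Set.indicator {x | c < ‖u τ x‖} (fun x => ENNReal.ofReal (‖fderiv ℝ (fun y => ‖u τ y‖) x‖ ^ 2)) x).toReal) :=
  fun _ _ _ _ hν hT hcl hLH hdec _ _ _ hc ht hΦ hfin =>
    levelSetModeration_pairing_le_sqrt_moderated hν hT hcl hLH hdec hc ht hΦ hfin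

end Summit.NavierStokesRegularity.NavierStokesRegularity.Theorems

end
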